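import Summits.QuantumFields.YangMills.Theorems.UnitScaleTiltFluctuationComparisonRegPrLiftFaceLoops

/-!
# Route `UnitScaleTilt` — crux K1bR-pr `FluctuationComparisonRegPr` (stmt-QuantumFields-19201 → `…L` of owner ruling g17-№1), stub
# `stub_oneStepSmallLift`, piece (L2) for INTERIOR-SUPPORTED corrections — the Γ-LEG LAYER, file 1: THE OPEN (0.4) LOOP TRANSPORTERS OF
# `U⋆ = E · faceSec V` FOR AN ARBITRARY CORRECTION `E` (support file `--supports stmt-QuantumFields-19201`)

Cell `ym3-torus` (HUMAN RULING D-0037, YM ladder rung R3), seat `ym3-torus-p1` gen 11 (UV side; cell memo HOME/UV3-NODE.md §20).  The fleet's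
face-supported (L2) chain (`…LiftFace{Loops,Avg,Kernel,Transport,Row,Bianchi,Plaq,Assembly,Cert}`, ★ym-ust-19201-p1 g2) closes
`ApproxSmallLift` at a block size `L` from a kernel table supported on the block EXIT bonds; its layer F1 (`loopHol_mulField_faceSec`)
uses that support essentially (every (0.4) loop meets exactly two corrected bonds).  The all-`L` linear lifts with gain `O(L⁻²)`
(this lineage's dual Whitney lift `DualWhitney.Zop`, p473948–p476131; p2 g9's tensor homotopy) are INTERIOR-supported: the staircase
legs `Γ`, `Γ′` of Bałaban's loops [Balaban1987RG1] (0.4) then pick up corrections too.  This file records the EXACT structure of the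
loop transporters for an ARBITRARY fine correction `E` (no support hypothesis), in any gauge group:

* §1 `rowProd_add`, `rowProd_congr`; the far end of the in-block part of a row is the far block's site at `μ`-offset `0`
  (`shiftN_blockSite_exit`).
* §2 `holAt_mulField_faceSec_stair`: on staircases `U⋆ = E` (staircases never exit their block, F1); **`rowProd_mulField_faceSec_split`**:
  the row of `L` bonds from `x_r = blockSite c₋ r` splits at its unique exit bond —
  `U⋆([x_r, x_r + Le_μ]) = E([x_r, x_r + (L−r_μ)e_μ]) · V(c) · E([x_r + (L−r_μ)e_μ, x_r + Le_μ])`; `axialAvg_mulField_faceSec_split` (`r = ctr`).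
* §3 the OPEN LOOP TRANSPORTER `openLoop U c i := W_c(i) · U(c) = U(Γ^σ_{c₋,r}) · U([x_r, x_r + Le_μ]) · U(Γ^{σ′}_{c₊,r})⁻¹` (`openLoop_eq`,
  from p1 g8's `AvgActionDefect.loopHol_eq`), and **`openLoop_mulField_faceSec`**: `openLoop U⋆ c (r,σ,σ′) = legIn E c r σ · V(c) · legOut E c r σ′`
  with `legIn` = (staircase of `c₋`) · (in-block part of the row) — a product of `E`-values on bonds of `B(c₋)` — and `legOut` = (far part of
  the row) · (staircase of `c₊`)⁻¹ — a product of `E`-values on bonds of `B(c₊)`.  For exit-supported `E` this is F1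
  (`legIn = E(exitBond c r)`, `legOut = 1`).

File 2 (`…LiftLegsAvg`) turns this into the first-order expansion of `Ū⋆(c)`: a COARSE GAUGE transformation (the staircase functional,
free by `approxLiftStep_of_gauge`) plus a LINE functional (generalised S-neutrality).  Elementary lattice geometry; nothing of Bałaban's
is asserted.
-/

noncomputable section

open scoped BigOperators

namespace Summit.QuantumFields.YangMills.Theorems.ApproxLift

open Literature.MathematicalPhysics.QuantumFieldTheory.Balaban1983to89
open T4Continuum BlockAveraging AveragingRT B10Eq47AxialChi BlockAveragingSection BlockAveragingSectionPlaq
open Summit.QuantumFields.YangMills.Theorems.AvgActionDefect (shiftN_apply holAt_walk_replicate walkEnd_replicate blockSite_shift loopHol_eq)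
open Summit.QuantumFields.BalabanUV.T4Continuum.Spine.NE7 (walkEnd_emb_stairWord)

variable {P : Params} {j : ℕ} {G : Type*} [GaugeGroup G]

/-! ## §1 Row products: splitting and congruence -/

/-- **ROW PRODUCTS SPLIT**: `U([x, x + (a+b)e_μ]) = U([x, x + a e_μ]) · U([x + a e_μ, x + (a+b) e_μ])`. -/
theorem rowProd_add (U : GaugeField P j G) (x : Site P j) (μ : Fin P.d) (a : ℕ) :
    ∀ b : ℕ, rowProd U x μ (a + b) = rowProd U x μ a * rowProd U (shiftN x μ a) μ b
  | 0 => by rw [Nat.add_zero, rowProd_zero, mul_one]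
  | b + 1 => by
    rw [← Nat.add_assoc, rowProd_succ, rowProd_add U x μ a b, rowProd_succ, shiftN_add, mul_assoc]

/-- Two configurations agreeing on the first `n` bonds of a row have the same row product. -/
theorem rowProd_congr {U U' : GaugeField P j G} {x : Site P j} {μ : Fin P.d} :
    ∀ n : ℕ, (∀ t, t < n → U ⟨shiftN x μ t, μ⟩ = U' ⟨shiftN x μ t, μ⟩) → rowProd U x μ n = rowProd U' x μ n
  | 0, _ => by rw [rowProd_zero, rowProd_zero]
  | n + 1, h => by
    rw [rowProd_succ, rowProd_succ, rowProd_congr n fun t ht => h t (Nat.lt_succ_of_lt ht), h n (Nat.lt_succ_self n)]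

/-- Off the exit bonds `E · faceSec V = E`. -/
theorem mulField_faceSec_of_not_exits' (E : GaugeField P j G) (V : GaugeField P (j + 1) G) {b : PBond P j}
    (hb : ¬ ExitsBlock b) : mulField E (faceSec V) b = E b := by
  rw [mulField_apply, faceSec_of_not_exits V hb, mul_one]

/-- On an exit bond `(E · faceSec V)(b) = E(b) · V(⟨blockOf b₋, b.dir⟩)`. -/
theorem mulField_faceSec_of_exits' (E : GaugeField P j G) (V : GaugeField P (j + 1) G) {b : PBond P j}
    (hb : ExitsBlock b) : mulField E (faceSec V) b = E b * V ⟨blockOf b.src, b.dir⟩ := by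
  rw [mulField_apply, faceSec_of_exits V hb]

/-- **THE FAR END OF THE IN-BLOCK PART OF A ROW**: `blockSite y r + (L − r_μ) e_μ = blockSite (y + e_μ) (r[μ ↦ 0])` — the site of the
neighbouring block at `μ`-offset `0` and the same transverse offsets (standing range). -/
theorem shiftN_blockSite_exit (hj : j + 1 ≤ P.m + P.K) (y : Site P (j + 1)) (r : Fin P.d → Fin P.L) (μ : Fin P.d) :
    shiftN (Site.blockSite y r) μ (P.L - (r μ : ℕ)) = Site.blockSite (y.shift μ) (Function.update r μ ⟨0, P.L_pos⟩) :=
  shiftN_blockSite_carry hj y r μ ⟨0, P.L_pos⟩ (by have := (r μ).isLt; simp only; omega)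

/-! ## §2 `U⋆ = E · faceSec V` on staircases and rows, for an arbitrary correction `E` -/

/-- **ON STAIRCASES `U⋆ = E`**: `U⋆(Γ^σ_{y,r}) = E(Γ^σ_{y,r})` — no bond of a staircase exits its block (F1
`not_exitsBlock_of_mem_stairWalk`), so `faceSec V = 1` there (standing range). -/
theorem holAt_mulField_faceSec_stair (hj : j + 1 ≤ P.m + P.K) (E : GaugeField P j G) (V : GaugeField P (j + 1) G)
    (y : Site P (j + 1)) (σ : Equiv.Perm (Fin P.d)) (r : Fin P.d → Fin P.L) :
    holAt (mulField E (faceSec V)) (walk (emb y) (stairWord σ (off r))) = holAt E (walk (emb y) (stairWord σ (off r))) :=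
  T4ReflectionCone.holAt_congr fun s hs => mulField_faceSec_of_not_exits' E V (not_exitsBlock_of_mem_stairWalk hj y σ r s hs)

/-- **THE ROW OF `U⋆` SPLITS AT ITS UNIQUE EXIT BOND** (general `E`; standing range): for `c = ⟨y, μ⟩` and `x_r = blockSite y r`,
`U⋆([x_r, x_r + Le_μ]) = E([x_r, x_r + (L − r_μ)e_μ]) · V(c) · E([x_r + (L − r_μ)e_μ, x_r + Le_μ])` — the first factor collects the
`L − r_μ` bonds of the row in `B(y)` (the last of them is the exit bond, whose `faceSec`-value `V(c)` is split off), the third the `r_μ`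
bonds in `B(y + e_μ)`. -/
theorem rowProd_mulField_faceSec_split (hj : j + 1 ≤ P.m + P.K) (E : GaugeField P j G) (V : GaugeField P (j + 1) G)
    (c : PBond P (j + 1)) (r : Fin P.d → Fin P.L) :
    rowProd (mulField E (faceSec V)) (Site.blockSite c.src r) c.dir P.L =
      rowProd E (Site.blockSite c.src r) c.dir (P.L - (r c.dir : ℕ)) * V c *
        rowProd E (shiftN (Site.blockSite c.src r) c.dir (P.L - (r c.dir : ℕ))) c.dir (r c.dir : ℕ) := by
  have hkL : (r c.dir : ℕ) < P.L := (r c.dir).isLt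
  -- which bonds of the row exit
  have hexit : ∀ t, t < P.L → (ExitsBlock (⟨shiftN (Site.blockSite c.src r) c.dir t, c.dir⟩ : PBond P j) ↔
      t = P.L - 1 - (r c.dir : ℕ)) := fun t ht => exitsBlock_row_iff hj c.src r c.dir ht
  -- split the row at `L − r_μ = (L − 1 − r_μ) + 1`
  have hsplit : rowProd (mulField E (faceSec V)) (Site.blockSite c.src r) c.dir P.L =
      rowProd (mulField E (faceSec V)) (Site.blockSite c.src r) c.dir (P.L - (r c.dir : ℕ)) *
        rowProd (mulField E (faceSec V)) (shiftN (Site.blockSite c.src r) c.dir (P.L - (r c.dir : ℕ))) c.dir (r c.dir : ℕ) := by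
    rw [← rowProd_add, Nat.sub_add_cancel hkL.le]
  have hL' : P.L - (r c.dir : ℕ) = (P.L - 1 - (r c.dir : ℕ)) + 1 := by omega
  rw [hsplit]
  congr 1
  · -- the in-block part: `E` on the first `L − 1 − r_μ` bonds, `E · V(c)` on the exit bond
    rw [hL', rowProd_succ, rowProd_succ]
    have h1 : rowProd (mulField E (faceSec V)) (Site.blockSite c.src r) c.dir (P.L - 1 - (r c.dir : ℕ)) =
        rowProd E (Site.blockSite c.src r) c.dir (P.L - 1 - (r c.dir : ℕ)) :=
      rowProd_congr (P.L - 1 - (r c.dir : ℕ)) fun t ht =>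
        mulField_faceSec_of_not_exits' E V fun hex => by have := (hexit t (by omega)).mp hex; omega
    have hex : ExitsBlock (⟨shiftN (Site.blockSite c.src r) c.dir (P.L - 1 - (r c.dir : ℕ)), c.dir⟩ : PBond P j) :=
      (hexit _ (by omega)).mpr rfl
    have h2 : mulField E (faceSec V) ⟨shiftN (Site.blockSite c.src r) c.dir (P.L - 1 - (r c.dir : ℕ)), c.dir⟩ =
        E ⟨shiftN (Site.blockSite c.src r) c.dir (P.L - 1 - (r c.dir : ℕ)), c.dir⟩ * V c := by
      rw [mulField_apply, row_exitBond c.src r c.dir, faceSec_exitBond hj V]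
    rw [h1, h2, mul_assoc]
  · -- the far part: no exit bond among the next `r_μ` bonds
    refine rowProd_congr (r c.dir : ℕ) fun t ht => mulField_faceSec_of_not_exits' E V fun hex => ?_
    rw [← shiftN_add] at hex
    have := (hexit (P.L - (r c.dir : ℕ) + t) (by omega)).mp hex
    omega

/-- **THE STRAIGHT TRANSPORTER SPLITS** (general `E`; standing range): `U⋆(c) = E([emb y, emb y + (h+1)e_μ]) · V(c) · E([…, emb y + Le_μ])`,
`h = (L−1)/2` (the centre row, `r = ctr`). -/
theorem axialAvg_mulField_faceSec_split (hj : j + 1 ≤ P.m + P.K) (E : GaugeField P j G) (V : GaugeField P (j + 1) G)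
    (c : PBond P (j + 1)) :
    axialAvg (mulField E (faceSec V)) c =
      rowProd E (emb c.src) c.dir (P.L - (P.L - 1) / 2) * V c *
        rowProd E (shiftN (emb c.src) c.dir (P.L - (P.L - 1) / 2)) c.dir ((P.L - 1) / 2) := by
  rw [axialAvg_eq_holAt_walk, holAt_walk_replicate, emb_eq_blockSite_ctr, rowProd_mulField_faceSec_split hj E V c (ctr P)]
  rfl

/-! ## §3 The open loop transporters -/

/-- **THE OPEN (0.4) LOOP TRANSPORTER** `W_c(i) · U(c)`: the loop variable of [Balaban1987RG1] (0.4) with its last leg `(−c)` removed, i.e.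
the parallel transport from the centre of `B(c₋)` to the centre of `B(c₊)` along `Γ ∪ [x, x′] ∪ (−Γ′)`. -/
def openLoop (U : GaugeField P j G) (c : PBond P (j + 1)) (i : Idx P) : G := loopHol U c i * axialAvg U c

/-- `W_c(i) = openLoop U c i · U(c)⁻¹`. -/
theorem loopHol_eq_openLoop_mul (U : GaugeField P j G) (c : PBond P (j + 1)) (i : Idx P) :
    loopHol U c i = openLoop U c i * (axialAvg U c)⁻¹ := by
  rw [openLoop, mul_inv_cancel_right]

/-- **`openLoop U c (r,σ,σ′) = U(Γ^σ_{c₋,r}) · U([x_r, x_r + Le_μ]) · U(Γ^{σ′}_{c₊,r})⁻¹`** (p1 g8's `loopHol_eq`; standing range). -/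
theorem openLoop_eq (hj : j + 1 ≤ P.m + P.K) (U : GaugeField P j G) (c : PBond P (j + 1))
    (r : Fin P.d → Fin P.L) (σ σ' : Equiv.Perm (Fin P.d)) :
    openLoop U c (r, σ, σ') =
      holAt U (walk (emb c.src) (stairWord σ (off r))) * rowProd U (Site.blockSite c.src r) c.dir P.L *
        (holAt U (walk (emb c.tgt) (stairWord σ' (off r))))⁻¹ := by
  rw [openLoop, loopHol_eq hj, inv_mul_cancel_right]

/-- **THE IN-BLOCK LEG** of the open loop of `U⋆ = E · faceSec V` at `(c; r, σ)`: `E(Γ^σ_{c₋,r}) · E([x_r, x_r + (L − r_μ)e_μ])` — a product of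
`E`-values on bonds of `B(c₋)` (the staircase and the in-block part of the row, exit bond included). -/
def legIn (E : GaugeField P j G) (c : PBond P (j + 1)) (r : Fin P.d → Fin P.L) (σ : Equiv.Perm (Fin P.d)) : G :=
  holAt E (walk (emb c.src) (stairWord σ (off r))) * rowProd E (Site.blockSite c.src r) c.dir (P.L - (r c.dir : ℕ))

/-- **THE FAR-BLOCK LEG** of the open loop of `U⋆` at `(c; r, σ′)`: `E([x_r + (L − r_μ)e_μ, x_r + Le_μ]) · E(Γ^{σ′}_{c₊,r})⁻¹` — a product of
`E`-values on bonds of `B(c₊)`. -/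
def legOut (E : GaugeField P j G) (c : PBond P (j + 1)) (r : Fin P.d → Fin P.L) (σ' : Equiv.Perm (Fin P.d)) : G :=
  rowProd E (shiftN (Site.blockSite c.src r) c.dir (P.L - (r c.dir : ℕ))) c.dir (r c.dir : ℕ) *
    (holAt E (walk (emb c.tgt) (stairWord σ' (off r))))⁻¹

/-- **THE OPEN LOOP TRANSPORTERS OF `U⋆ = E · faceSec V` FOR AN ARBITRARY CORRECTION `E`** (standing range):
`openLoop U⋆ c (r, σ, σ′) = legIn E c r σ · V(c) · legOut E c r σ′`. -/
theorem openLoop_mulField_faceSec (hj : j + 1 ≤ P.m + P.K) (E : GaugeField P j G) (V : GaugeField P (j + 1) G)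
    (c : PBond P (j + 1)) (r : Fin P.d → Fin P.L) (σ σ' : Equiv.Perm (Fin P.d)) :
    openLoop (mulField E (faceSec V)) c (r, σ, σ') = legIn E c r σ * V c * legOut E c r σ' := by
  rw [openLoop_eq hj, holAt_mulField_faceSec_stair hj E V c.src σ r, holAt_mulField_faceSec_stair hj E V c.tgt σ' r,
    rowProd_mulField_faceSec_split hj, legIn, legOut]
  simp only [mul_assoc]

/-- The straight transporter is the open loop at the centre index with trivial staircases:
`U⋆(c) = legIn E c ctr 1 · V(c) · legOut E c ctr 1` needs the empty staircase; we record the row form directly. -/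
theorem axialAvg_mulField_faceSec_split' (hj : j + 1 ≤ P.m + P.K) (E : GaugeField P j G) (V : GaugeField P (j + 1) G)
    (c : PBond P (j + 1)) :
    axialAvg (mulField E (faceSec V)) c =
      rowProd E (Site.blockSite c.src (ctr P)) c.dir (P.L - (ctr P c.dir : ℕ)) * V c *
        rowProd E (shiftN (Site.blockSite c.src (ctr P)) c.dir (P.L - (ctr P c.dir : ℕ))) c.dir (ctr P c.dir : ℕ) := by
  rw [axialAvg_eq_holAt_walk, holAt_walk_replicate, emb_eq_blockSite_ctr, rowProd_mulField_faceSec_split hj E V c (ctr P)]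

/-- For an EXIT-SUPPORTED correction the legs collapse to F1: `legIn E c r σ = E(exitBond c r)` … -/
theorem legIn_of_exitSupported (hj : j + 1 ≤ P.m + P.K) {E : GaugeField P j G} (hE : ExitSupported E)
    (V : GaugeField P (j + 1) G) (c : PBond P (j + 1)) (r : Fin P.d → Fin P.L) (σ : Equiv.Perm (Fin P.d)) :
    legIn E c r σ = E (exitBond c r) := by
  have h1 : holAt E (walk (emb c.src) (stairWord σ (off r))) = 1 := by
    rw [← holAt_mulField_faceSec_stair hj E V, holAt_stairWalk_eq_one hj hE V]
  have hk : (r c.dir : ℕ) < P.L := (r c.dir).isLt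
  have hL' : P.L - (r c.dir : ℕ) = (P.L - 1 - (r c.dir : ℕ)) + 1 := by omega
  have hpt : ∀ t, t < P.L - 1 - (r c.dir : ℕ) → t ≠ P.L - 1 - (r c.dir : ℕ) →
      E ⟨shiftN (Site.blockSite c.src r) c.dir t, c.dir⟩ = 1 := fun t ht _ =>
    hE _ fun hex => by have := (exitsBlock_row_iff hj c.src r c.dir (by omega)).mp hex; omega
  have h2 : rowProd E (Site.blockSite c.src r) c.dir (P.L - 1 - (r c.dir : ℕ)) = 1 := by
    rw [rowProd_eq_of_single E (Site.blockSite c.src r) c.dir (P.L - 1 - (r c.dir : ℕ)) (P.L - 1 - (r c.dir : ℕ)) hpt,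
      if_neg (lt_irrefl _)]
  rw [legIn, h1, one_mul, hL', rowProd_succ, h2, one_mul, row_exitBond]

/-- … and `legOut E c r σ′ = 1`. -/
theorem legOut_of_exitSupported (hj : j + 1 ≤ P.m + P.K) {E : GaugeField P j G} (hE : ExitSupported E)
    (V : GaugeField P (j + 1) G) (c : PBond P (j + 1)) (r : Fin P.d → Fin P.L) (σ' : Equiv.Perm (Fin P.d)) :
    legOut E c r σ' = 1 := by
  have h1 : holAt E (walk (emb c.tgt) (stairWord σ' (off r))) = 1 := by
    rw [← holAt_mulField_faceSec_stair hj E V, holAt_stairWalk_eq_one hj hE V]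
  have hk : (r c.dir : ℕ) < P.L := (r c.dir).isLt
  have hpt : ∀ t, t < (r c.dir : ℕ) → t ≠ (r c.dir : ℕ) →
      E ⟨shiftN (shiftN (Site.blockSite c.src r) c.dir (P.L - (r c.dir : ℕ))) c.dir t, c.dir⟩ = 1 := fun t ht _ =>
    hE _ fun hex => by
      rw [← shiftN_add] at hex
      have := (exitsBlock_row_iff hj c.src r c.dir (by omega : P.L - (r c.dir : ℕ) + t < P.L)).mp hex
      omega
  have h2 : rowProd E (shiftN (Site.blockSite c.src r) c.dir (P.L - (r c.dir : ℕ))) c.dir (r c.dir : ℕ) = 1 := by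
    rw [rowProd_eq_of_single E _ c.dir (r c.dir : ℕ) (r c.dir : ℕ) hpt, if_neg (lt_irrefl _)]
  rw [legOut, h1, inv_one, mul_one, h2]


/-! ## §4 The legs as holonomies of single walks (the words a kernel consumer sums over) -/

/-- THE IN-WORD at `(c; r, σ)`: the staircase word `Γ^σ` to the offsets `r`, then `L − r_μ` steps `+e_μ` (up to and including the exit
bond of the row). -/
def inWord (c : PBond P (j + 1)) (r : Fin P.d → Fin P.L) (σ : Equiv.Perm (Fin P.d)) : List (Letter P.d) :=
  stairWord σ (off r) ++ List.replicate (P.L - (r c.dir : ℕ)) (c.dir, true)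

/-- THE OUT-BASE at `(c; r)`: the first site of the row beyond the face, `x_r + (L − r_μ)e_μ = blockSite c₊ (r[μ ↦ 0])`. -/
def outBase (c : PBond P (j + 1)) (r : Fin P.d → Fin P.L) : Site P j :=
  shiftN (Site.blockSite c.src r) c.dir (P.L - (r c.dir : ℕ))

/-- THE OUT-WORD at `(c; r, σ′)`: the remaining `r_μ` steps `+e_μ` of the row (inside `B(c₊)`), then the staircase `Γ^{σ′}` of `B(c₊)`
backwards to its centre. -/
def outWord (c : PBond P (j + 1)) (r : Fin P.d → Fin P.L) (σ' : Equiv.Perm (Fin P.d)) : List (Letter P.d) :=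
  List.replicate (r c.dir : ℕ) (c.dir, true) ++ wordRev (stairWord σ' (off r))

/-- `outBase c r = blockSite c₊ (r[μ ↦ 0])` (standing range). -/
theorem outBase_eq (hj : j + 1 ≤ P.m + P.K) (c : PBond P (j + 1)) (r : Fin P.d → Fin P.L) :
    outBase c r = Site.blockSite c.tgt (Function.update r c.dir ⟨0, P.L_pos⟩) :=
  shiftN_blockSite_exit hj c.src r c.dir

/-- The row from the out-base ends at `blockSite c₊ r`, the end of the staircase `Γ^{σ′}` of `B(c₊)` (standing range). -/
theorem walkEnd_outBase_replicate (hj : j + 1 ≤ P.m + P.K) (c : PBond P (j + 1)) (r : Fin P.d → Fin P.L)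
    (σ' : Equiv.Perm (Fin P.d)) :
    walkEnd (outBase c r) (List.replicate (r c.dir : ℕ) (c.dir, true)) = walkEnd (emb c.tgt) (stairWord σ' (off r)) := by
  rw [walkEnd_replicate, outBase, ← shiftN_add, Nat.sub_add_cancel (r c.dir).isLt.le, ← blockSite_shift hj,
    walkEnd_emb_stairWord]
  rfl

/-- **`legIn` IS THE HOLONOMY OF THE IN-WORD** from the centre of `B(c₋)`. -/
theorem legIn_eq_holAt (E : GaugeField P j G) (c : PBond P (j + 1)) (r : Fin P.d → Fin P.L) (σ : Equiv.Perm (Fin P.d)) :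
    legIn E c r σ = holAt E (walk (emb c.src) (inWord c r σ)) := by
  rw [legIn, inWord, walk_append, holAt_append, walkEnd_emb_stairWord, holAt_walk_replicate]

/-- **`legOut` IS THE HOLONOMY OF THE OUT-WORD** from the out-base (standing range). -/
theorem legOut_eq_holAt (hj : j + 1 ≤ P.m + P.K) (E : GaugeField P j G) (c : PBond P (j + 1)) (r : Fin P.d → Fin P.L)
    (σ' : Equiv.Perm (Fin P.d)) :
    legOut E c r σ' = holAt E (walk (outBase c r) (outWord c r σ')) := by
  rw [legOut, outWord, walk_append, holAt_append, holAt_walk_replicate, walkEnd_outBase_replicate hj c r σ',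
    holAt_walk_wordRev]
  rfl

/-- The in-word followed by the out-word is the open loop: `openLoop U⋆ c (r,σ,σ′) = E(in-walk) · V(c) · E(out-walk)` (standing range). -/
theorem openLoop_mulField_faceSec_eq_holAt (hj : j + 1 ≤ P.m + P.K) (E : GaugeField P j G) (V : GaugeField P (j + 1) G)
    (c : PBond P (j + 1)) (r : Fin P.d → Fin P.L) (σ σ' : Equiv.Perm (Fin P.d)) :
    openLoop (mulField E (faceSec V)) c (r, σ, σ') =
      holAt E (walk (emb c.src) (inWord c r σ)) * V c * holAt E (walk (outBase c r) (outWord c r σ')) := by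
  rw [openLoop_mulField_faceSec hj, legIn_eq_holAt, legOut_eq_holAt hj]

/-- Lengths: `|inWord| = |Γ^σ| + (L − r_μ)`, … -/
theorem length_inWord (c : PBond P (j + 1)) (r : Fin P.d → Fin P.L) (σ : Equiv.Perm (Fin P.d)) :
    (inWord c r σ).length = (stairWord σ (off r)).length + (P.L - (r c.dir : ℕ)) := by
  rw [inWord, List.length_append, List.length_replicate]

/-- Reversal preserves word length (local copy of `B13AvgCorrStokesLoop.length_wordRev`). -/
private theorem length_wordRev' {d : ℕ} (w : List (Letter d)) : (wordRev w).length = w.length := by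
  simp [wordRev]

/-- … `|outWord| = r_μ + |Γ^{σ′}|`. -/
theorem length_outWord (c : PBond P (j + 1)) (r : Fin P.d → Fin P.L) (σ' : Equiv.Perm (Fin P.d)) :
    (outWord c r σ').length = (r c.dir : ℕ) + (stairWord σ' (off r)).length := by
  rw [outWord, List.length_append, List.length_replicate, length_wordRev']

end Summit.QuantumFields.YangMills.Theorems.ApproxLift

end
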